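import Summits.Ventures.PercRepro.C026ProdCSCounts
import Summits.Ventures.PercRepro.C026ProdCFEveryP
import Summits.Ventures.PercRepro.C026FactorTwo

/-!
# THEOREM PROD on a gluing: (CS) composes under the square rooms (p5, gen 16)

mine-3's COROLLARY 1 (`proofs/MINE3-PRODUCT.md` §2), two-part form: for a marked multigraph `G`
that is p6's 3-terminal gluing of its two parts at the marks, if both parts satisfy (CS) and the two
one-sided square rooms (SR_a), (SR_b), then `G` satisfies (CS). In the six counts of
`C026ProdCFGluing` (`T = #Apart`, `P`, `Q`, `Z`, `Mₐ = #{b iso}`, `M_b = #{a iso}`):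

* (CS): `(T − P − Q + Z)² ≤ (Mₐ − T)(M_b − T)`, i.e. `#N²² ≤ #ac|b · #bc|a` (`CSCounts`; the tree's
  `CSIneq` of `C026FactorTwo`, `#BotM² ≤ #ac|b · #bc|a`, is the same inequality: `csIneq_iff_csCounts`);
* (SR_a): `(T − Q)² ≤ (Mₐ − T)·T`, i.e. `(#N² + #X_a)² ≤ #ac|b · #Apart` with
  `#X_a = P − Z` the `a`-bit-only configurations (`SRa`); (SR_b) alike (`SRb`).

The count generator `genC G a b c = (Z, P − Z, Q − Z, T − P − Q + Z, Mₐ − T, M_b − T)` of a graph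
lies in `K` exactly when (CS), (SR_a), (SR_b) hold (`memKC_genC`: the other conditions are the
`K_CF` facts of `counts_facts`), the six counts multiply over a gluing, and `prod_cs_counts` with
two generators closes (`csCounts_of_gluing`; `csIneq_of_gluing` in the tree's vocabulary). With
`card_nTwo_add`, `card_cell_ac_add`, `card_cell_bc_add` of `C026ProdCFEvents`, `CSCounts` is the count
inequality `#N² · #N² ≤ #ac|b · #bc|a` (`csCounts_iff_nTwo`); by AM–GM it gives (2×) and (CF)
(`twoTimes_of_csCounts`, `slackCF_nonneg_of_csCounts`).
-/

namespace PercRepro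

open Finset

namespace MultiGraph

section ProdCSGluing

variable {V E : Type*} (G : MultiGraph V E)

/-- **(CS) in the six counts**: `(T − P − Q + Z)² ≤ (Mₐ − T)(M_b − T)` (`#N²² ≤ #ac|b · #bc|a`). -/
def CSCounts [Fintype E] (a b c : V) : Prop :=
  (G.apartCount a b c - G.apartIsoBCount a b c - G.apartIsoACount a b c + G.apartBotCount a b c) ^ 2 ≤
    (G.isoBCount a b c - G.apartCount a b c) * (G.isoACount a b c - G.apartCount a b c)

/-- **(SR_a), the `a`-side square room**: `(T − Q)² ≤ (Mₐ − T)·T`, i.e.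
`(#N² + #X_a)² ≤ #ac|b · #Apart`. -/
def SRa [Fintype E] (a b c : V) : Prop :=
  (G.apartCount a b c - G.apartIsoACount a b c) ^ 2 ≤
    (G.isoBCount a b c - G.apartCount a b c) * G.apartCount a b c

/-- **(SR_b), the `b`-side square room**: `(T − P)² ≤ (M_b − T)·T`. -/
def SRb [Fintype E] (a b c : V) : Prop :=
  (G.apartCount a b c - G.apartIsoBCount a b c) ^ 2 ≤
    (G.isoACount a b c - G.apartCount a b c) * G.apartCount a b c

/-- The count generator of a marked multigraph. -/
noncomputable def genC [Fintype E] (a b c : V) : ProdCS.GenC :=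
  ⟨(G.apartBotCount a b c : ℝ), ((G.apartIsoBCount a b c - G.apartBotCount a b c : ℤ) : ℝ),
    ((G.apartIsoACount a b c - G.apartBotCount a b c : ℤ) : ℝ),
    ((G.apartCount a b c - G.apartIsoBCount a b c - G.apartIsoACount a b c +
      G.apartBotCount a b c : ℤ) : ℝ),
    ((G.isoBCount a b c - G.apartCount a b c : ℤ) : ℝ),
    ((G.isoACount a b c - G.apartCount a b c : ℤ) : ℝ)⟩

variable {G}

open Classical in
/-- **(CS) is the count inequality** `#N² · #N² ≤ #ac|b · #bc|a`. -/
theorem csCounts_iff_nTwo [Fintype E] (a b c : V) :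
    G.CSCounts a b c ↔
      ((univ.filter fun ω : Config E => G.NTwo ω a b c).card ^ 2 : ℤ) ≤
        ((univ.filter fun ω : Config E => G.Conn ω c a ∧ ¬ G.Conn ω c b).card : ℤ) *
          ((univ.filter fun ω : Config E => G.Conn ω c b ∧ ¬ G.Conn ω c a).card : ℤ) := by
  have h1 := card_nTwo_add (G := G) a b c
  have h2 := card_cell_ac_add (G := G) a b c
  have h3 := card_cell_bc_add (G := G) a b c
  unfold CSCounts isoBCount isoACount apartIsoBCount apartIsoACount apartCount apartBotCount
  zify at h1 h2 h3
  have e1 : ((univ.filter fun ω : Config E => G.NTwo ω a b c).card : ℤ) =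
      ((univ.filter fun ω : Config E => G.Apart ω a b c).card : ℤ) -
        ((univ.filter fun ω : Config E => G.Apart ω a b c ∧ G.IsoMark ω b a c).card : ℤ) -
        ((univ.filter fun ω : Config E => G.Apart ω a b c ∧ G.IsoMark ω a b c).card : ℤ) +
        ((univ.filter fun ω : Config E => G.Apart ω a b c ∧ G.IsBot ω a b c).card : ℤ) := by
    linarith
  have e2 : ((univ.filter fun ω : Config E => G.Conn ω c a ∧ ¬ G.Conn ω c b).card : ℤ) =
      ((univ.filter fun ω : Config E => G.IsoMark ω b a c).card : ℤ) -
        ((univ.filter fun ω : Config E => G.Apart ω a b c).card : ℤ) := by linarith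
  have e3 : ((univ.filter fun ω : Config E => G.Conn ω c b ∧ ¬ G.Conn ω c a).card : ℤ) =
      ((univ.filter fun ω : Config E => G.IsoMark ω a b c).card : ℤ) -
        ((univ.filter fun ω : Config E => G.Apart ω a b c).card : ℤ) := by linarith
  rw [e1, e2, e3]

/-- **The count generator of a graph lies in `K` iff (CS), (SR_a), (SR_b) hold** (the remaining
conditions are the `K_CF` facts of the six counts). -/
theorem memKC_genC [Fintype E] {a b c : V} (hcs : G.CSCounts a b c) (hsa : G.SRa a b c)
    (hsb : G.SRb a b c) : ProdCS.GenC.MemKC (G.genC a b c) := by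
  obtain ⟨f₁, f₂, f₃, f₄, f₅, f₆, f₇, f₈⟩ := counts_facts (G := G) a b c
  unfold CSCounts at hcs
  unfold SRa at hsa
  unfold SRb at hsb
  have ht : (G.genC a b c).t = (G.apartCount a b c : ℝ) := by
    simp only [ProdCS.GenC.t, genC]; push_cast; ring
  refine ⟨?_, ?_, ?_, ?_, ?_, ?_, ?_, ?_, ?_, ?_, ?_⟩
  · simp only [genC]; exact_mod_cast f₁
  · simp only [genC]; exact_mod_cast (sub_nonneg.2 f₂)
  · simp only [genC]; exact_mod_cast (sub_nonneg.2 f₃)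
  · simp only [genC]; exact_mod_cast (by linarith : (0 : ℤ) ≤ G.apartCount a b c -
      G.apartIsoBCount a b c - G.apartIsoACount a b c + G.apartBotCount a b c)
  · simp only [genC]; exact_mod_cast (sub_nonneg.2 f₅)
  · simp only [genC]; exact_mod_cast (sub_nonneg.2 f₆)
  · simp only [genC]; exact_mod_cast (by linarith : G.apartIsoBCount a b c - G.apartBotCount a b c ≤
      G.isoBCount a b c - G.apartCount a b c)
  · simp only [genC]; exact_mod_cast (by linarith : G.apartIsoACount a b c - G.apartBotCount a b c ≤
      G.isoACount a b c - G.apartCount a b c)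
  · simp only [genC]; exact_mod_cast hcs
  · rw [ht]; simp only [genC]
    have : (G.apartCount a b c - G.apartIsoBCount a b c - G.apartIsoACount a b c +
        G.apartBotCount a b c + (G.apartIsoBCount a b c - G.apartBotCount a b c)) ^ 2 ≤
        (G.isoBCount a b c - G.apartCount a b c) * G.apartCount a b c := by
      have e : G.apartCount a b c - G.apartIsoBCount a b c - G.apartIsoACount a b c +
          G.apartBotCount a b c + (G.apartIsoBCount a b c - G.apartBotCount a b c) =
          G.apartCount a b c - G.apartIsoACount a b c := by ring
      rw [e]; exact hsa
    exact_mod_cast this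
  · rw [ht]; simp only [genC]
    have : (G.apartCount a b c - G.apartIsoBCount a b c - G.apartIsoACount a b c +
        G.apartBotCount a b c + (G.apartIsoACount a b c - G.apartBotCount a b c)) ^ 2 ≤
        (G.isoACount a b c - G.apartCount a b c) * G.apartCount a b c := by
      have e : G.apartCount a b c - G.apartIsoBCount a b c - G.apartIsoACount a b c +
          G.apartBotCount a b c + (G.apartIsoACount a b c - G.apartBotCount a b c) =
          G.apartCount a b c - G.apartIsoBCount a b c := by ring
      rw [e]; exact hsb
    exact_mod_cast this

open Classical in
/-- **THEOREM PROD on a gluing** (mine-3's Corollary 1, two parts): if both parts of a 3-terminal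
gluing satisfy (CS), (SR_a) and (SR_b), then the gluing satisfies (CS). The six counts of `G` are the
products of those of the parts, and `prod_cs_counts` with the two count generators closes. -/
theorem csCounts_of_gluing [Fintype E] {a b c : V} {side : E → Bool} (hg : G.IsGluing a b c side)
    (h₁ : (G.part side true).CSCounts a b c ∧ (G.part side true).SRa a b c ∧
      (G.part side true).SRb a b c)
    (h₀ : (G.part side false).CSCounts a b c ∧ (G.part side false).SRa a b c ∧
      (G.part side false).SRb a b c) :
    G.CSCounts a b c := by
  have hK₁ := memKC_genC h₁.1 h₁.2.1 h₁.2.2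
  have hK₀ := memKC_genC h₀.1 h₀.2.1 h₀.2.2
  have key := ProdCS.prod_cs_counts (Finset.univ : Finset Bool)
    (fun s => (G.part side s).genC a b c) fun s _ => by cases s <;> assumption
  simp only [Fintype.prod_bool] at key
  -- the six counts of `G` are the products
  unfold CSCounts
  rw [apartCount_gluing hg, apartIsoBCount_gluing hg, apartIsoACount_gluing hg,
    apartBotCount_gluing hg, isoBCount_gluing hg, isoACount_gluing hg]
  have ht : ∀ s, ((G.part side s).genC a b c).t = ((G.part side s).apartCount a b c : ℝ) :=
    fun s => by simp only [ProdCS.GenC.t, genC]; push_cast; ring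
  simp only [ht] at key
  simp only [genC] at key
  push_cast at key
  have key' : ((((G.part side true).apartCount a b c * (G.part side false).apartCount a b c -
      (G.part side true).apartIsoBCount a b c * (G.part side false).apartIsoBCount a b c -
      (G.part side true).apartIsoACount a b c * (G.part side false).apartIsoACount a b c +
      (G.part side true).apartBotCount a b c * (G.part side false).apartBotCount a b c) ^ 2 : ℤ) : ℝ) ≤
      ((((G.part side true).isoBCount a b c * (G.part side false).isoBCount a b c -
        (G.part side true).apartCount a b c * (G.part side false).apartCount a b c) *
        ((G.part side true).isoACount a b c * (G.part side false).isoACount a b c -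
        (G.part side true).apartCount a b c * (G.part side false).apartCount a b c) : ℤ) : ℝ) := by
    push_cast
    nlinarith [key]
  exact_mod_cast key'

open Classical in
/-- **The tree's (CS) is the six-count (CS)**: `C026FactorTwo`'s `CSIneq` (`#BotM² ≤ #ac|b · #bc|a`)
is `CSCounts` (`#BotM = #N²` by Lemma Φ, `card_botM_eq_card_nTwo`). -/
theorem csIneq_iff_csCounts [Fintype E] [DecidableEq E] (a b c : V) :
    G.CSIneq a b c ↔ G.CSCounts a b c := by
  -- `csCounts_iff_nTwo` is stated with the classical `DecidableEq E`; re-read it with the instance at hand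
  have key : G.CSCounts a b c ↔
      ((univ.filter fun ω : Config E => G.NTwo ω a b c).card ^ 2 : ℤ) ≤
        ((univ.filter fun ω : Config E => G.Conn ω c a ∧ ¬ G.Conn ω c b).card : ℤ) *
          ((univ.filter fun ω : Config E => G.Conn ω c b ∧ ¬ G.Conn ω c a).card : ℤ) := by
    convert csCounts_iff_nTwo (G := G) a b c using 4
    repeat first | rfl | exact Subsingleton.elim _ _ | congr 1
  rw [key]
  unfold CSIneq
  rw [card_botM_eq_card_nTwo]
  have e1 : (univ.filter fun ω : Config E => G.Conn ω a c ∧ ¬ G.Conn ω a b) =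
      univ.filter fun ω : Config E => G.Conn ω c a ∧ ¬ G.Conn ω c b := by
    refine Finset.filter_congr fun ω _ => ?_
    constructor
    · rintro ⟨hac, hab⟩
      exact ⟨hac.symm, fun h => hab (hac.trans h)⟩
    · rintro ⟨hca, hcb⟩
      exact ⟨hca.symm, fun h => hcb (hca.trans h)⟩
  have e2 : (univ.filter fun ω : Config E => G.Conn ω b c ∧ ¬ G.Conn ω a b) =
      univ.filter fun ω : Config E => G.Conn ω c b ∧ ¬ G.Conn ω c a := by
    refine Finset.filter_congr fun ω _ => ?_
    constructor
    · rintro ⟨hbc, hab⟩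
      exact ⟨hbc.symm, fun h => hab (h.symm.trans hbc.symm)⟩
    · rintro ⟨hcb, hca⟩
      exact ⟨hcb.symm, fun h => hca (hcb.trans h.symm)⟩
  rw [e1, e2]
  constructor
  · intro h; exact_mod_cast h
  · intro h; exact_mod_cast h

open Classical in
/-- **THEOREM PROD on a gluing in the tree's vocabulary**: (CS) (`CSIneq`) + (SR_a) + (SR_b) on both
parts gives `CSIneq` on the gluing. -/
theorem csIneq_of_gluing [Fintype E] [DecidableEq E] {a b c : V} {side : E → Bool}
    (hg : G.IsGluing a b c side)
    (h₁ : (G.part side true).CSIneq a b c ∧ (G.part side true).SRa a b c ∧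
      (G.part side true).SRb a b c)
    (h₀ : (G.part side false).CSIneq a b c ∧ (G.part side false).SRa a b c ∧
      (G.part side false).SRb a b c) :
    G.CSIneq a b c :=
  (csIneq_iff_csCounts a b c).mpr (csCounts_of_gluing hg
    ⟨(csIneq_iff_csCounts a b c).mp h₁.1, h₁.2.1, h₁.2.2⟩
    ⟨(csIneq_iff_csCounts a b c).mp h₀.1, h₀.2.1, h₀.2.2⟩)

/-- **AM–GM in the six counts**: from `N² ≤ 𝒜ℬ` with `𝒜, ℬ ≥ 0`, `2N ≤ 𝒜 + ℬ`. -/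
theorem two_mul_le_add_of_sq_le_mul {N A B : ℤ} (hA : 0 ≤ A) (hB : 0 ≤ B)
    (h : N ^ 2 ≤ A * B) : 2 * N ≤ A + B := by
  have h1 : (2 * N) ^ 2 ≤ (A + B) ^ 2 := by nlinarith [sq_nonneg (A - B)]
  exact (abs_le_of_sq_le_sq' h1 (by linarith)).2

open Classical in
/-- **(CS) gives (2×)**: `CSCounts` implies mine-3's `TwoTimes` (`2·#N² ≤ #ac|b + #bc|a`) — AM–GM. -/
theorem twoTimes_of_csCounts [Fintype E] {a b c : V} (h : G.CSCounts a b c) : G.TwoTimes a b c := by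
  rw [csCounts_iff_nTwo] at h
  unfold TwoTimes
  have key := two_mul_le_add_of_sq_le_mul (by positivity) (by positivity) h
  exact_mod_cast key

/-- **(CS) gives (CF)**: `CSCounts` implies `0 ≤ Δ_CF` (AM–GM, then `N ≤ 2N`). -/
theorem slackCF_nonneg_of_csCounts [Fintype E] {a b c : V} (h : G.CSCounts a b c) :
    0 ≤ G.slackCF a b c := by
  obtain ⟨f₁, f₂, f₃, f₄, f₅, f₆, f₇, f₈⟩ := counts_facts (G := G) a b c
  unfold CSCounts at h
  rw [slackCF_eq_counts]
  have key := two_mul_le_add_of_sq_le_mul (by linarith) (by linarith) h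
  linarith

end ProdCSGluing

end MultiGraph

end PercRepro
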